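import Summits.NavierStokesRegularity.NavierStokesRegularity.Theorems.HubbleDynamoNoSelfExcitedDynamoStubEnstrophyBalance
import Summits.NavierStokesRegularity.NavierStokesRegularity.Theorems.HubbleDynamoNoSelfExcitedDynamoBackusRegime
import HarnessLib

/-!
# Crux `HubbleDynamo.NoSelfExcitedDynamo` (stmt-NavierStokesRegularity-1934), line `registered`:
# stub `stub_recurrentVanishingOfEnstrophyDecay` — a uniformly recurrent eternal flow with decaying
# enstrophy vanishes

Helper file (`--supports stmt-NavierStokesRegularity-1934`; theorems only, sorry-free). Let `(W, Q)`
be a classical solution of Leray's backward system `∂ₛW + ½W + ½(y·∇)W + (W·∇)W + ∇Q = ΔW`,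
`div W = 0` on the whole similarity space–time `ℝ × ℝ³` (`IsBackwardLeraySolutionOn univ 1 W Q`) in
the uniform profile class `(1 + ‖y‖)^{k+1} ‖Dᵏ W(s, ·)(y)‖ ≤ K_k`, which is UNIFORMLY RECURRENT in the
similarity time (return shifts `σ` in every window `[a, a + L]`, closeness uniform on
`[−R, R] × closedBall 0 R`) and whose enstrophy `E(s) = ∫ ‖curl W(s)‖²` tends to `0` as `s → +∞`.
Then `W ≡ 0` (`stub_recurrentVanishingOfEnstrophyDecay`).

Proof. Fix `s`. The recurrence hypothesis with `ε = 1/(n+1)`, `R = |s| + n`, `a = n` yields return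
shifts `σₙ ≥ n` with `‖W(s + σₙ, y) − W(s, y)‖ < 1/(n+1)` for `‖y‖ ≤ n`, so `W(s + σₙ, ·) → W(s, ·)`
pointwise. The uniform bound `‖D²W‖ ≤ K₂` upgrades this to convergence of the Jacobians: by the
second-order mean value (Landau) inequality `‖h(y + e) − h(y) − Dh(y)e‖ ≤ M‖e‖²`
(`recvan_taylor`), `r‖(Df − Dg)(y)e‖ ≤ ‖(f − g)(y + re)‖ + ‖(f − g)(y)‖ + 2Mr²‖e‖²` for every `r > 0`
(`recvan_fderiv_apply_tendsto`), and convergence on the three basis vectors is convergence in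
operator norm (`recvan_opNorm_le_sum`, `recvan_clm_tendsto`). Hence `‖curl W(s + σₙ, y)‖² →
‖curl W(s, y)‖²` pointwise (`curl = curlCLM ∘ D`), and with the `s`-uniform dominator
`(κK)²(1+|y|)⁻⁴` of the profile class (`enstrophy_slice_integrable`, `enstrophy_integrable_weight`)
dominated convergence gives `E(s) = lim E(s + σₙ) = 0` (as `s + σₙ → +∞`). So the continuous
integrand `‖curl W(s)‖²` vanishes (`backusRegime_eq_zero_of_integral_sq_norm_eq_zero`), i.e.
`curl W ≡ 0`, and the curl-free Liouville theorem `stub_curlFreeLiouville` finishes.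

## References

* G. Koch, N. Nadirashvili, G. Seregin, V. Šverák, *Liouville theorems for the Navier–Stokes
  equations and applications*, Acta Math. 203 (2009) 83–105, Lemma 3.1 (the curl-free, divergence-free
  Liouville step). [KochNadirashviliSereginSverak2009]
* The interpolation of a first derivative between the function and its second derivative
  (Landau–Kolmogorov inequality `‖f′‖ ≤ ‖f(· + r) − f‖/r + Mr`) is folklore.
-/

noncomputable section

-- the registered stub namespace repeats the summit name `NavierStokesRegularity` (summit = problem)
set_option linter.dupNamespace false

namespace Summit.NavierStokesRegularity.NavierStokesRegularity.Theorems.NoSelfExcitedDynamo.Registered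

open Set MeasureTheory Filter Topology InnerProductSpace Function
open scoped RealInnerProductSpace Laplacian ContDiff
open Literature.Analysis.FluidPDE

/-! ### Landau interpolation: pointwise convergence plus a uniform `C²` bound gives convergence of
the derivatives -/

/-- **Second-order mean value inequality.** If `h ∈ C²` with `‖D²h‖ ≤ B` everywhere, then
`‖h(y + e) − h(y) − Dh(y) e‖ ≤ B‖e‖²` (the curve `t ↦ h(y + te) − t Dh(y)e` on `[0, 1]` has speed
`‖(Dh(y + te) − Dh(y)) e‖ ≤ B t ‖e‖²`, `Dh` being `B`-Lipschitz). -/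
theorem recvan_taylor {E F : Type*} [NormedAddCommGroup E] [NormedSpace ℝ E] [NormedAddCommGroup F]
    [NormedSpace ℝ F] {h : E → F} (hh : ContDiff ℝ 2 h) {B : ℝ}
    (hB : ∀ z, ‖iteratedFDeriv ℝ 2 h z‖ ≤ B) (y e : E) :
    ‖h (y + e) - h y - fderiv ℝ h y e‖ ≤ B * ‖e‖ ^ 2 := by
  have hB0 : 0 ≤ B := (norm_nonneg _).trans (hB y)
  have hd1 : ContDiff ℝ 1 (fderiv ℝ h) := hh.fderiv_right (m := 1) (by norm_num)
  have hdiff : Differentiable ℝ h := hh.differentiable two_ne_zero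
  -- `Dh` is `B`-Lipschitz
  have hlip : ∀ z w : E, ‖fderiv ℝ h z - fderiv ℝ h w‖ ≤ B * ‖z - w‖ := fun z w =>
    (convex_univ).norm_image_sub_le_of_norm_fderiv_le (fun x _ => hd1.differentiable one_ne_zero x)
      (fun x _ => by
        rw [← norm_iteratedFDeriv_one (𝕜 := ℝ) (fderiv ℝ h), norm_iteratedFDeriv_fderiv]
        exact hB x)
      (mem_univ w) (mem_univ z)
  -- the curve `φ t = h (y + t e) − t Dh(y)e`
  set v : F := fderiv ℝ h y e with hv
  have hline : ∀ t : ℝ, HasDerivAt (fun t : ℝ => y + t • e) e t := fun t => by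
    simpa using ((hasDerivAt_id' t).smul_const e).const_add y
  have hφ : ∀ t : ℝ, HasDerivAt (fun t : ℝ => h (y + t • e) - t • v)
      (fderiv ℝ h (y + t • e) e - v) t := by
    intro t
    have h1 : HasDerivAt (fun t : ℝ => h (y + t • e)) (fderiv ℝ h (y + t • e) e) t :=
      (hdiff (y + t • e)).hasFDerivAt.comp_hasDerivAt t (hline t)
    have h2 : HasDerivAt (fun t : ℝ => t • v) v t := by
      simpa using (hasDerivAt_id' t).smul_const v
    exact h1.sub h2
  have key : ‖(h (y + (1 : ℝ) • e) - (1 : ℝ) • v) - (h (y + (0 : ℝ) • e) - (0 : ℝ) • v)‖ ≤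
      B * ‖e‖ ^ 2 := by
    refine norm_image_sub_le_of_norm_deriv_le_segment_01' (fun t _ => (hφ t).hasDerivWithinAt)
      fun t ht => ?_
    have ht1 : |t| ≤ 1 := abs_le.2 ⟨by linarith [ht.1], ht.2.le⟩
    calc ‖fderiv ℝ h (y + t • e) e - v‖ = ‖(fderiv ℝ h (y + t • e) - fderiv ℝ h y) e‖ := by
          rw [sub_apply]
      _ ≤ ‖fderiv ℝ h (y + t • e) - fderiv ℝ h y‖ * ‖e‖ := ContinuousLinearMap.le_opNorm _ _
      _ ≤ B * ‖y + t • e - y‖ * ‖e‖ := by gcongr; exact hlip _ _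
      _ = B * (|t| * ‖e‖) * ‖e‖ := by rw [add_sub_cancel_left, norm_smul, Real.norm_eq_abs]
      _ ≤ B * (1 * ‖e‖) * ‖e‖ := by gcongr
      _ = B * ‖e‖ ^ 2 := by ring
  have e1 : (h (y + (1 : ℝ) • e) - (1 : ℝ) • v) - (h (y + (0 : ℝ) • e) - (0 : ℝ) • v) =
      h (y + e) - h y - v := by
    simp only [one_smul, zero_smul, add_zero, sub_zero]
    abel
  rw [e1] at key
  exact key

/-- **Landau interpolation along a pointwise convergent sequence.** If `fₙ → g` pointwise, all maps
being `C²` with `‖D²fₙ‖, ‖D²g‖ ≤ M`, then `Dfₙ(y) e → Dg(y) e` for every `y` and `e`: for `r > 0`,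
`r ‖(Dfₙ(y) − Dg(y)) e‖ ≤ ‖(fₙ − g)(y + re)‖ + ‖(fₙ − g)(y)‖ + 2Mr²‖e‖²` (`recvan_taylor` twice);
choose `r` with `4M‖e‖²r ≤ ε`, then `n` large. -/
theorem recvan_fderiv_apply_tendsto {E F : Type*} [NormedAddCommGroup E] [NormedSpace ℝ E]
    [NormedAddCommGroup F] [NormedSpace ℝ F] {f : ℕ → E → F} {g : E → F} {M : ℝ}
    (hf : ∀ n, ContDiff ℝ 2 (f n)) (hg : ContDiff ℝ 2 g)
    (hfM : ∀ n z, ‖iteratedFDeriv ℝ 2 (f n) z‖ ≤ M) (hgM : ∀ z, ‖iteratedFDeriv ℝ 2 g z‖ ≤ M)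
    (hlim : ∀ z, Tendsto (fun n => f n z) atTop (𝓝 (g z))) (y e : E) :
    Tendsto (fun n => fderiv ℝ (f n) y e) atTop (𝓝 (fderiv ℝ g y e)) := by
  have hM0 : 0 ≤ M := (norm_nonneg _).trans (hgM y)
  rw [Metric.tendsto_nhds]
  intro ε hε
  -- the step `r` with `4 M ‖e‖² r ≤ ε`
  have hA0 : 0 ≤ M * ‖e‖ ^ 2 := by positivity
  set r : ℝ := ε / (4 * (M * ‖e‖ ^ 2) + 1) with hr
  have hr0 : 0 < r := by positivity
  have hAr : 4 * (M * ‖e‖ ^ 2) * r ≤ ε := by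
    rw [hr, mul_div_assoc', div_le_iff₀ (by positivity)]
    nlinarith
  have h1 := Metric.tendsto_nhds.1 (hlim (y + r • e)) (r * ε / 4) (by positivity)
  have h2 := Metric.tendsto_nhds.1 (hlim y) (r * ε / 4) (by positivity)
  filter_upwards [h1, h2] with n hn1 hn2
  rw [dist_eq_norm] at hn1 hn2 ⊢
  have T1 := recvan_taylor (hf n) (hfM n) y (r • e)
  have T2 := recvan_taylor hg hgM y (r • e)
  rw [norm_smul, Real.norm_of_nonneg hr0.le, mul_pow, ContinuousLinearMap.map_smul] at T1 T2
  -- the four-term decomposition of `r • (Dfₙ(y) e − Dg(y) e)`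
  have eq : r • (fderiv ℝ (f n) y e - fderiv ℝ g y e) =
      (f n (y + r • e) - g (y + r • e)) - (f n y - g y)
        - (f n (y + r • e) - f n y - r • fderiv ℝ (f n) y e)
        + (g (y + r • e) - g y - r • fderiv ℝ g y e) := by
    rw [smul_sub]
    abel
  have i4 : ‖(f n (y + r • e) - g (y + r • e)) - (f n y - g y)
        - (f n (y + r • e) - f n y - r • fderiv ℝ (f n) y e)
        + (g (y + r • e) - g y - r • fderiv ℝ g y e)‖ ≤
      ‖f n (y + r • e) - g (y + r • e)‖ + ‖f n y - g y‖
        + ‖f n (y + r • e) - f n y - r • fderiv ℝ (f n) y e‖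
        + ‖g (y + r • e) - g y - r • fderiv ℝ g y e‖ := by
    set P := f n (y + r • e) - g (y + r • e)
    set P₀ := f n y - g y
    set Rf := f n (y + r • e) - f n y - r • fderiv ℝ (f n) y e
    set Rg := g (y + r • e) - g y - r • fderiv ℝ g y e
    linarith [norm_add_le (P - P₀ - Rf) Rg, norm_sub_le (P - P₀) Rf, norm_sub_le P P₀]
  have hlt : ‖r • (fderiv ℝ (f n) y e - fderiv ℝ g y e)‖ < r * ε := by
    rw [eq]
    nlinarith [i4, hn1, hn2, T1, T2, mul_le_mul_of_nonneg_left hAr hr0.le]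
  rw [norm_smul, Real.norm_of_nonneg hr0.le] at hlt
  exact lt_of_mul_lt_mul_left hlt hr0.le

/-- The operator norm of a linear map on `ℝ³` is at most the sum of the norms of the images of the
three standard basis vectors (`x = ∑ xᵢ eᵢ`, `|xᵢ| ≤ ‖x‖`). -/
theorem recvan_opNorm_le_sum {F : Type*} [NormedAddCommGroup F] [NormedSpace ℝ F]
    (T : EuclideanSpace ℝ (Fin 3) →L[ℝ] F) :
    ‖T‖ ≤ ∑ i, ‖T (EuclideanSpace.single i 1)‖ := by
  refine ContinuousLinearMap.opNorm_le_bound T (Finset.sum_nonneg fun i _ => norm_nonneg _)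
    fun x => ?_
  have hx : ∑ i, x i • EuclideanSpace.single i (1 : ℝ) = x := by
    have h := (EuclideanSpace.basisFun (Fin 3) ℝ).sum_repr x
    simpa only [EuclideanSpace.basisFun_apply, EuclideanSpace.basisFun_repr] using h
  calc ‖T x‖ = ‖∑ i, x i • T (EuclideanSpace.single i 1)‖ := by
        conv_lhs => rw [← hx]
        rw [map_sum]
        simp only [map_smul]
    _ ≤ ∑ i, ‖x i • T (EuclideanSpace.single i 1)‖ := norm_sum_le _ _
    _ ≤ ∑ i, ‖T (EuclideanSpace.single i 1)‖ * ‖x‖ := Finset.sum_le_sum fun i _ => by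
        rw [norm_smul, mul_comm]
        exact mul_le_mul_of_nonneg_left (PiLp.norm_apply_le x i) (norm_nonneg _)
    _ = (∑ i, ‖T (EuclideanSpace.single i 1)‖) * ‖x‖ := (Finset.sum_mul _ _ _).symm

/-- On `ℝ³`, convergence of continuous linear maps on every vector is convergence in operator norm
(`recvan_opNorm_le_sum` applied to the differences). -/
theorem recvan_clm_tendsto {F : Type*} [NormedAddCommGroup F] [NormedSpace ℝ F]
    {L : ℕ → EuclideanSpace ℝ (Fin 3) →L[ℝ] F} {L₀ : EuclideanSpace ℝ (Fin 3) →L[ℝ] F}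
    (h : ∀ e, Tendsto (fun n => L n e) atTop (𝓝 (L₀ e))) : Tendsto L atTop (𝓝 L₀) := by
  refine tendsto_sub_nhds_zero_iff.1 (squeeze_zero_norm'
    (Eventually.of_forall fun n => recvan_opNorm_le_sum (L n - L₀)) ?_)
  have hs : Tendsto (fun n => ∑ i : Fin 3, ‖(L n - L₀) (EuclideanSpace.single i 1)‖) atTop
      (𝓝 (∑ i : Fin 3, (0 : ℝ))) :=
    tendsto_finsetSum _ fun i _ => by
      simpa only [sub_apply] using
        tendsto_iff_norm_sub_tendsto_zero.1 (h (EuclideanSpace.single i 1))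
  simpa using hs

/-! ### The stub -/

/-- **Stub `stub_recurrentVanishingOfEnstrophyDecay`.** A UNIFORMLY RECURRENT eternal profile-class
solution of Leray's backward system whose enstrophy `E(s) = ∫‖curl W(s)‖²` tends to `0` as
`s → +∞` vanishes identically. For each `s` the recurrence hypothesis yields return shifts `σₙ ≥ n`
with `W(s + σₙ, ·) → W(s, ·)` pointwise; the uniform bound on `D²W` upgrades this to
`DW(s + σₙ, y) → DW(s, y)` (Landau interpolation, `recvan_fderiv_apply_tendsto`,
`recvan_clm_tendsto`), hence `‖curl W(s + σₙ, y)‖² → ‖curl W(s, y)‖²`; with the uniform dominator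
`(κK)²(1+|y|)⁻⁴` (`enstrophy_slice_integrable`) dominated convergence gives
`E(s) = lim E(s + σₙ) = 0`, so `curl W ≡ 0` (`backusRegime_eq_zero_of_integral_sq_norm_eq_zero`)
and the curl-free Liouville theorem `stub_curlFreeLiouville` finishes. -/
theorem stub_recurrentVanishingOfEnstrophyDecay :
    ∀ (W : ℝ → EuclideanSpace ℝ (Fin 3) → EuclideanSpace ℝ (Fin 3)) (Q : ℝ → EuclideanSpace ℝ (Fin 3) → ℝ),
      IsBackwardLeraySolutionOn univ 1 W Q →
      (∀ k : ℕ, ∃ K : ℝ, ∀ s y, (1 + ‖y‖) ^ (k + 1) * ‖iteratedFDeriv ℝ k (W s) y‖ ≤ K) →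
      (∀ ε : ℝ, 0 < ε → ∀ R : ℝ, ∃ L : ℝ, 0 < L ∧ ∀ a : ℝ, ∃ σ ∈ Icc a (a + L),
        ∀ s ∈ Icc (-R) R, ∀ y ∈ Metric.closedBall (0 : EuclideanSpace ℝ (Fin 3)) R,
          ‖W (s + σ) y - W s y‖ < ε) →
      (∀ ε : ℝ, 0 < ε → ∃ T : ℝ, ∀ s, T ≤ s → ∫ y, ‖curl (W s) y‖ ^ 2 < ε) →
      ∀ s y, W s y = 0 := by
  intro W Q hW hprof hrec hdecay
  -- (0) smoothness of the slices and the profile constants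
  have hWs : ∀ t, ContDiff ℝ ∞ (W t) := fun t => hW.smooth_velocity.contDiff_slice (mem_univ t)
  have hW3 : ∀ t, ContDiff ℝ 3 (W t) := fun t => (hWs t).of_le (by norm_cast)
  have hW2 : ∀ t, ContDiff ℝ 2 (W t) := fun t => (hWs t).of_le (by norm_cast)
  have hW1 : ∀ t, ContDiff ℝ 1 (W t) := fun t => (hWs t).of_le (by norm_cast)
  obtain ⟨K, hK0, hK⟩ := enstrophy_decay hW3 hprof
  have hint : ∀ t, Integrable (fun y => ‖curl (W t) y‖ ^ 2) := fun t =>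
    (enstrophy_slice_integrable (hW3 t) hK0 (hK t)).1
  have hdom : ∀ t y, ‖curl (W t) y‖ ^ 2 ≤ (‖curlCLM‖ * K) ^ 2 * ((1 + ‖y‖) ^ 4)⁻¹ := fun t =>
    (enstrophy_slice_integrable (hW3 t) hK0 (hK t)).2.2.2.2.2.2.2
  -- the uniform bound on `D²W`
  obtain ⟨K₂, hK₂⟩ := hprof 2
  have hD2 : ∀ t y, ‖iteratedFDeriv ℝ 2 (W t) y‖ ≤ K₂ := fun t y =>
    (le_mul_of_one_le_left (norm_nonneg _) (one_le_pow₀ (by linarith [norm_nonneg y]))).trans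
      (hK₂ t y)
  -- the enstrophy vanishes at every similarity time
  have hE : ∀ s, ∫ y, ‖curl (W s) y‖ ^ 2 = 0 := by
    intro s
    -- (1) return shifts `σₙ ≥ n`, `‖W (s + σₙ) y − W s y‖ < 1/(n+1)` for `‖y‖ ≤ n`
    have hshift : ∀ n : ℕ, ∃ σ : ℝ, (n : ℝ) ≤ σ ∧
        ∀ y : EuclideanSpace ℝ (Fin 3), ‖y‖ ≤ n → ‖W (s + σ) y - W s y‖ < 1 / ((n : ℝ) + 1) := by
      intro n
      have hn0 : (0 : ℝ) ≤ n := n.cast_nonneg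
      obtain ⟨L, -, hL⟩ := hrec (1 / ((n : ℝ) + 1)) (by positivity) (|s| + n)
      obtain ⟨σ, hσ, hclose⟩ := hL n
      refine ⟨σ, hσ.1, fun y hy => hclose s ⟨?_, ?_⟩ y ?_⟩
      · linarith [neg_abs_le s]
      · linarith [le_abs_self s]
      · rw [Metric.mem_closedBall, dist_zero_right]
        linarith [abs_nonneg s]
    choose σ hσn hσc using hshift
    -- (2) pointwise convergence along the return shifts
    have hpt : ∀ y, Tendsto (fun n => W (s + σ n) y) atTop (𝓝 (W s y)) := by
      intro y
      obtain ⟨N, hN⟩ := exists_nat_ge ‖y‖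
      refine tendsto_sub_nhds_zero_iff.1
        (squeeze_zero_norm' ?_ tendsto_one_div_add_atTop_nhds_zero_nat)
      filter_upwards [eventually_ge_atTop N] with n hn
      exact (hσc n y (hN.trans (Nat.cast_le.2 hn))).le
    -- (3) convergence of the Jacobians, hence of the enstrophy densities
    have hD : ∀ y, Tendsto (fun n => fderiv ℝ (W (s + σ n)) y) atTop (𝓝 (fderiv ℝ (W s) y)) :=
      fun y => recvan_clm_tendsto fun e =>
        recvan_fderiv_apply_tendsto (fun n => hW2 (s + σ n)) (hW2 s) (fun n z => hD2 _ z) (hD2 s)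
          hpt y e
    have hlim : ∀ y, Tendsto (fun n => ‖curl (W (s + σ n)) y‖ ^ 2) atTop
        (𝓝 (‖curl (W s) y‖ ^ 2)) := by
      intro y
      have h := ((curlCLM.continuous.tendsto _).comp (hD y)).norm.pow 2
      simpa only [Function.comp_def, curl_eq_curlCLM] using h
    -- (4) dominated convergence: `E(s + σₙ) → E(s)`, while `E(s + σₙ) → 0`
    have h1 : Tendsto (fun n => ∫ y, ‖curl (W (s + σ n)) y‖ ^ 2) atTop
        (𝓝 (∫ y, ‖curl (W s) y‖ ^ 2)) := by
      refine tendsto_integral_of_dominated_convergence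
        (fun y => (‖curlCLM‖ * K) ^ 2 * ((1 + ‖y‖) ^ 4)⁻¹)
        (fun n => ((continuous_curl (hW1 _)).norm.pow 2).aestronglyMeasurable)
        (enstrophy_integrable_weight _) (fun n => ae_of_all _ fun y => ?_) (ae_of_all _ hlim)
      rw [Real.norm_of_nonneg (sq_nonneg _)]
      exact hdom _ y
    have h2 : Tendsto (fun n => ∫ y, ‖curl (W (s + σ n)) y‖ ^ 2) atTop (𝓝 0) := by
      rw [Metric.tendsto_nhds]
      intro ε hε
      obtain ⟨T, hT⟩ := hdecay ε hε
      filter_upwards [(tendsto_natCast_atTop_atTop (R := ℝ)).eventually_ge_atTop (T - s)]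
        with n hn
      rw [dist_zero_right, Real.norm_of_nonneg (integral_nonneg fun y => sq_nonneg _)]
      exact hT _ (by linarith [hσn n])
    exact tendsto_nhds_unique h1 h2
  -- (5) the vorticity vanishes, and the curl-free Liouville theorem finishes
  have hcurl : ∀ s y, curl (W s) y = 0 := fun s =>
    backusRegime_eq_zero_of_integral_sq_norm_eq_zero (continuous_curl (hW1 s)) (hint s) (hE s)
  exact stub_curlFreeLiouville W Q hW hprof hcurl

end Summit.NavierStokesRegularity.NavierStokesRegularity.Theorems.NoSelfExcitedDynamo.Registered

end
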